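import Summits.Schanuel.Schanuel.Theorems.RootDecomp1EGenericityFloor01

/-!
# RootDecomp1EGenericityFloor — lens 2, generation 38: THE GENERICITY FLOOR of route RootDecomp1E (RULE E-R19's yardstick) — continuation (RootDecomp1EGenericityFloor02): `exists_expPoly_ne_zero` (the functions `t`, `e^{ct}` are algebraically independent over ℚ(θ)) and `countable_mvPolynomial_rat`

(lens-2 g38 GENERICITY FLOOR [HOME/decomp-schanuel-lens-2/g38/port/RootDecomp1EGenericityFloor01.lean 5821235e… (256 l) + …02.lean ca3de805… (305 l), copy-ready per NOTE L1838; source GenericScale.lean §7 (ed.1 b58a0d29… / ed.2 cf4f06e4…); critic VERDICT L1833 (C): INSTRUMENT «GENERICITY FLOOR» ACCEPTED on service lane (α) as the 1E YARDSTICK of RULE E-R19; PORT GO own chain]; port by census-1 gen 16 in three parts — see the PORT NOTE of part 01; `--supports stmt-Schanuel-31409`; rung 0.)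
-/

noncomputable section

open Complex MvPolynomial
open scoped IntermediateField.algebraAdjoinAdjoin
namespace Summit.Schanuel.Schanuel.Theorems.RootDecomp1EGenericityFloor

open Filter Topology

variable {k : ℕ}

/-- evaluation in stages: a polynomial-valued substitution followed by evaluation -/
private theorem polynomial_eval_aeval (g : Fin (k + 2) → Polynomial ℂ) (s : ℂ)
    (P : MvPolynomial (Fin (k + 2)) ℚ) :
    Polynomial.eval s (aeval g P) = aeval (fun i => Polynomial.eval s (g i)) P := by
  induction P using MvPolynomial.induction_on with
  | C a => simp
  | add p q hp hq => simp only [map_add, Polynomial.eval_add, hp, hq]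
  | mul_X p i hp => simp only [map_mul, MvPolynomial.aeval_X, Polynomial.eval_mul, hp]

variable {k : ℕ}

/-- **the functions `t` and `e^{ct}` (`c ≠ 0`) are algebraically independent over `ℚ(θ)`**, `θ`
algebraically independent over `ℚ`: a non-zero rational polynomial `P(U, T, X)` gives a non-identically-
vanishing exponential polynomial `t ↦ P(e^{ct}, t, θ)`. -/
theorem exists_expPoly_ne_zero {θ : Fin k → ℂ} (hθ : AlgebraicIndependent ℚ θ) {c : ℂ} (hc : c ≠ 0)
    {P : MvPolynomial (Fin (k + 2)) ℚ} (hP : P ≠ 0) : ∃ t : ℂ, expPoly θ c P t ≠ 0 := by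
  classical
  by_contra hall
  push Not at hall
  -- G u t := P(u, t, θ)
  set G : ℂ → ℂ → ℂ := fun u t => aeval (Fin.cons u (Fin.cons t θ) : Fin (k + 2) → ℂ) P with hG
  -- Step 1: G u t = 0 for every u ≠ 0 and every t (periodicity + infinitely many roots)
  have step1 : ∀ u : ℂ, u ≠ 0 → ∀ t : ℂ, G u t = 0 := by
    intro u hu t
    set t₀ : ℂ := Complex.log u / c with ht₀
    set τ : ℂ := (2 * Real.pi * I) / c with hτ
    have hτ0 : τ ≠ 0 := by
      rw [hτ]; exact div_ne_zero (by simp [Real.pi_ne_zero, Complex.I_ne_zero]) hc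
    have hexp : ∀ n : ℕ, cexp (c * (t₀ + n * τ)) = u := by
      intro n
      have h1 : c * (t₀ + n * τ) = Complex.log u + n * (2 * Real.pi * I) := by
        rw [ht₀, hτ]; field_simp
      rw [h1, Complex.exp_add, Complex.exp_log hu, Complex.exp_nat_mul_two_pi_mul_I, mul_one]
    -- R(s) := P(u, t₀ + s τ, θ) as a polynomial in s
    set g : Fin (k + 2) → Polynomial ℂ := Fin.cons (Polynomial.C u)
      (Fin.cons (Polynomial.C t₀ + Polynomial.C τ * Polynomial.X) fun j => Polynomial.C (θ j)) with hg
    set R : Polynomial ℂ := aeval g P with hR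
    have hReval : ∀ s : ℂ, Polynomial.eval s R = G u (t₀ + s * τ) := by
      intro s
      have hpt : (fun i => Polynomial.eval s (g i)) =
          (Fin.cons u (Fin.cons (t₀ + s * τ) θ) : Fin (k + 2) → ℂ) := by
        funext i
        refine Fin.cases ?_ (fun i' => Fin.cases ?_ (fun j => ?_) i') i
        · simp [hg]
        · simp [hg]; ring
        · simp [hg]
      rw [hR, polynomial_eval_aeval, hpt]
    have hRroots : ∀ n : ℕ, R.IsRoot (n : ℂ) := by
      intro n
      rw [Polynomial.IsRoot.def, hReval]
      have := hall (t₀ + n * τ)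
      rw [expPoly, hexp n] at this
      simpa [hG] using this
    have hR0 : R = 0 := by
      refine Polynomial.eq_zero_of_infinite_isRoot R ?_
      have hinj : Function.Injective (fun n : ℕ => (n : ℂ)) := Nat.cast_injective
      exact Set.infinite_of_injective_forall_mem hinj hRroots
    have := hReval ((t - t₀) / τ)
    rw [hR0, Polynomial.eval_zero] at this
    rw [this]
    congr 1
    field_simp
    ring
  -- Step 2: every rational specialisation of (U, T) with U ≠ 0 kills P over ℚ(θ)
  have hGq : ∀ u t : ℚ, aeval (Fin.cons ((u : ℚ) : ℂ) (Fin.cons ((t : ℚ) : ℂ) θ) : Fin (k + 2) → ℂ) P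
      = G u t := fun u t => rfl
  have step2 : ∀ u t : ℚ, u ≠ 0 →
      aeval (Fin.cons (C u) (Fin.cons (C t) X) : Fin (k + 2) → MvPolynomial (Fin k) ℚ) P = 0 := by
    intro u t hu
    apply (algebraicIndependent_iff.mp hθ)
    rw [aeval_aeval_cons_cons]
    have hX : (fun j => (aeval θ : MvPolynomial (Fin k) ℚ →ₐ[ℚ] ℂ) (X j)) = θ := by
      funext j; exact MvPolynomial.aeval_X θ j
    rw [hX, hGq]
    exact step1 u (by exact_mod_cast hu) t
  -- Step 3: P = 0 by `funext_set` on the box {U ≠ 0} × ℚ × ℚ^k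
  let bx : Fin (k + 2) → Set ℚ := Fin.cons {x : ℚ | x ≠ 0} (fun _ => Set.univ)
  have hbox : ∀ i : Fin (k + 2), (bx i).Infinite := by
    refine Fin.cases ?_ (fun i' => ?_)
    · simp only [bx, Fin.cons_zero]
      have : ({x : ℚ | x ≠ 0}) = ({(0 : ℚ)} : Set ℚ)ᶜ := by ext x; simp
      rw [this]
      exact (Set.finite_singleton (0 : ℚ)).infinite_compl
    · simp only [bx, Fin.cons_succ]
      exact Set.infinite_univ
  have hP_zero : P = 0 := by
    refine MvPolynomial.funext_set bx hbox fun x hx => ?_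
    rw [map_zero]
    have hx0 : x 0 ≠ 0 := by
      have := hx 0 (Set.mem_univ _)
      simpa [bx] using this
    have h2 := step2 (x 0) (x 1) hx0
    have h3 := congrArg (MvPolynomial.aeval (fun j : Fin k => x j.succ.succ)) h2
    rw [map_zero] at h3
    rw [← h3]
    -- both sides are evaluations of P at x
    have key : ∀ Q : MvPolynomial (Fin (k + 2)) ℚ, MvPolynomial.eval x Q =
        MvPolynomial.aeval (fun j : Fin k => x j.succ.succ)
          (aeval (Fin.cons (C (x 0)) (Fin.cons (C (x 1)) X) :
            Fin (k + 2) → MvPolynomial (Fin k) ℚ) Q) := by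
      intro Q
      induction Q using MvPolynomial.induction_on with
      | C a => simp
      | add p q hp hq => simp only [map_add, hp, hq]
      | mul_X p i hp =>
        simp only [map_mul, MvPolynomial.eval_X, MvPolynomial.aeval_X, hp]
        congr 1
        refine Fin.cases ?_ (fun i' => Fin.cases ?_ (fun j => ?_) i') i
        · simp
        · simp
        · simp only [Fin.cons_succ, MvPolynomial.aeval_X]
    exact key P
  exact hP hP_zero

/-- countability of rational polynomials in finitely many variables [folklore] -/
private theorem countable_mvPolynomial_rat (n : ℕ) : Countable (MvPolynomial (Fin n) ℚ) :=
  Function.Injective.countable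
    (f := (AddMonoidAlgebra.coeff : MvPolynomial (Fin n) ℚ → (Fin n →₀ ℕ) →₀ ℚ))
    AddMonoidAlgebra.coeff_injective

variable {m : ℕ}

end Summit.Schanuel.Schanuel.Theorems.RootDecomp1EGenericityFloor

end
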